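import Summits.BirchSwinnertonDyer.BirchSwinnertonDyer.Theorems.ByReductionTypeAtTwoTorsionEulerCharCount
import HarnessLib

set_option linter.dupNamespace false -- `…BirchSwinnertonDyer.BirchSwinnertonDyer…` is the cell's nested layout (D-0017)
set_option autoImplicit false

/-!
# Greenberg LNM 1716 Lemma 4.7 WITH RATIONAL `p`-TORSION, part 3a: the index inequality `[∏_{v∈S} 𝒦_{v,0}[p^∞] : Ψ(A₀/Sel₀)] ≤ #D`
# over an abstract receptacle `δ` for Cassels' cokernel at an auxiliary place `v₀` (no hypothesis on `E(K)[p]`)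

Cell `bsd-2adic` (run/shared/lean/pub/bsd-2adic/), seat `bsd-2adic-tower-1` GEN 31; `--supports stmt-BirchSwinnertonDyer-19271`
(helper). THEOREMS ONLY (no definition, no named fact, no `sorry`); closes no item; nothing booked; BSD is not proved by any of this.

R. Greenberg, *Iwasawa theory for elliptic curves*, LNM 1716 (1999), §4 Lemma 4.7 (pp. 107–108): `|ker g|·|E(F)_p| =
|ker r|·|(Sel_E(F_∞)_p)_Γ|`, via the snake over Cassels' `𝒫^Σ(F)/𝒢^Σ(F) ≅ E(F)_p^∧` (p. 104). Parts 1–2 (`…TorsionEulerCharKerG`,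
`…TorsionEulerCharCount`) supply the embedding `Ψ : A₀/Sel₀ ↪ ∏ 𝒦_{v,0}[p^∞]` with its range criterion at `v₀`, the erase-one lift,
and the coinvariant representatives. Here the DEFECT is received by ANY additive map `δ` on `H¹(Γ_{K_{v₀}}, E)(p)` into a finite
group `C` whose kernel is `loc_{v₀}(U)`, `U` = the classes unramified outside `S ∪ {v₀}` vanishing locally on `S` and at `∞` (the
honest instance is the projection onto `C_{v₀} = H¹(Γ_{K_{v₀}}, E)(p)/loc_{v₀}(U)`, Cassels' cokernel read at `v₀`):

* `natCard_pi_le_of_defect` — **`#∏_{v∈S} 𝒦_{v,0}[p^∞] ≤ #Ψ(A₀/Sel₀) · #(δ ∘ loc_{v₀})(Θ)`**, `Θ` = the classes unramified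
  outside `S ∪ {v₀}`, dying over `K_∞` on `S`, zero at `∞`: `Θ ↠ ∏ 𝒦` (erase-one at `v₀`), and the kernel of `δ ∘ loc_{v₀}` on
  `Θ` lands in `Ψ(A₀/Sel₀)` (part 1's criterion, after correcting by `U`); then `#∏𝒦 = #ΦS(N)·[∏𝒦 : ΦS(N)]` and
  `[∏𝒦 : ΦS(N)] ∣ [Θ : N] = #(δ ∘ loc_{v₀})(Θ)` (`AddSubgroup.index_map_dvd`, `index_ker`).

HONEST FRAMING: kernel-checked index calculus over tree theorems; a step of ONE half of a printed lemma (the half that does not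
use Lemma 4.6). Closes no item; no summit statement is proved; the Birch–Swinnerton-Dyer conjecture is NOT proved by any of this.

References: [GreenbergLNM1716] §4 p. 104, Lemmas 4.6–4.7 (pp. 105–108), Prop. 4.13 and p. 123; [GreenbergVatsal2000] §2
pp. 16–17; [MilneADT2006] I Thm. 4.10, Thm. 6.13.
-/

noncomputable section

open scoped Classical NumberField

open NumberField IsDedekindDomain Field

namespace Summit.BirchSwinnertonDyer.BirchSwinnertonDyer.Theorems.TorsionEulerChar

open Literature.NumberTheory.EllipticCurves Literature.NumberTheory.GaloisRepresentations
  WeierstrassCurve ZpExtension Literature.NumberTheory.EllipticCurves.IwasawaAlgebra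
  Literature.NumberTheory.EllipticCurves.IwasawaDual
  Literature.NumberTheory.EllipticCurves.GreenbergVatsal2000 Literature.NumberTheory.EllipticCurves.GreenbergSelmer
  Literature.NumberTheory.EllipticCurves.Rank1Residual Summit.BirchSwinnertonDyer.Rank1Residual.X2

/-! ## §1 `[∏ 𝒦 : Ψ(A₀/Sel₀)] ≤ #D` -/

variable {K : Type} [Field K] [NumberField K] (W : WeierstrassCurve K) [W.IsElliptic] (p : ℕ) [hp : Fact p.Prime]
  (κ : ZpExtension K p) {γ : absoluteGaloisGroup K}

set_option maxHeartbeats 800000 in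
-- (one index computation through two sealed auxiliary maps; the default budget covers about a third of it)
/-- **(I) `[∏_{v∈S} 𝒦_{v,0}[p^∞] : Ψ(A₀/Sel₀)] ≤ #D`.** Data: part 1's embedding `Ψ` with its range criterion at `v₀`
(`hΨrange`); the classes `Θ` (unramified outside `S ∪ {v₀}`, dying over `K_∞` on `S`, zero at `∞`) through a membership
description `hΘ`; the group `U ≤ Θ` of classes vanishing on `S` (`hU`); the local map `lamP : Θ → H¹(Γ_{K_{v₀}}, E)(p)` at `v₀`
(`hlamP`); and ANY additive `δ` on `H¹(Γ_{K_{v₀}}, E)(p)` with kernel exactly `loc_{v₀}(U)` (`hδ`) into a finite group. Then the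
index of `Ψ(A₀/Sel₀)` in `∏ 𝒦` is at most `#(δ ∘ lamP)(Θ)`: `Θ ↠ ∏ 𝒦` (erase-one at `v₀`,
`exists_lift_of_pi_localTowerKerPrimary`) and a class of `Θ` killed by `δ ∘ lamP` is, up to `U`, a class vanishing at `v₀`, whose
vector lies in `Ψ(A₀/Sel₀)` by the criterion. [cite: GreenbergLNM1716, §4 Lemma 4.7 (pp. 107–108), Prop. 4.13 and p. 123] -/
theorem natCard_pi_le_of_defect {C : Type*} [AddCommGroup C] [Finite C]
    (hSel : Finite (W.selmerGroupPInfty p))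
    (S : Finset (HeightOneSpectrum (𝓞 K))) (hS : ∀ v ∉ S, ((p : ℕ) : 𝓞 K) ∉ v.asIdeal ∧ W.HasGoodReductionAt v)
    (v₀ : HeightOneSpectrum (𝓞 K)) (hv₀ : v₀ ∉ S)
    (Ψ : W.KerG κ 0 →+ (∀ v : S, W.localTowerKerPrimary κ (v.1.adicCompletion K) 0))
    (hΨrange : ∀ Y : W.subgroupH1 p (⊤ : Subgroup (absoluteGaloisGroup K)),
        Y ∈ unramifiedOutside (⊤ : Subgroup (absoluteGaloisGroup K)) (W.geomPrimaryTorsion p) p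
            ((↑S : Set (HeightOneSpectrum (𝓞 K))) ∪ {v₀}) →
        (∀ v ∈ S, Literature.NumberTheory.EllipticCurves.resOfLe (localPoints W (v.adicCompletion K))
            (Subgroup.comap_mono le_top :
              localSubgroup κ.kerSubgroup (v.adicCompletion K) ≤
                localSubgroup (⊤ : Subgroup (absoluteGaloisGroup K)) (v.adicCompletion K))
            (W.localResOver p ⊤ (v.adicCompletion K) Y) = 0) →
        W.localResOver p ⊤ (v₀.adicCompletion K) Y = 0 →
        (∀ w : InfinitePlace K, W.localResOver p ⊤ w.Completion Y = 0) →
        ∃ q : W.KerG κ 0, ∀ v : S,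
          ((Ψ q v : W.localTowerKerPrimary κ (v.1.adicCompletion K) 0) :
              discreteH1 (localSubgroup (κ.layerSubgroup 0) (v.1.adicCompletion K)) (localPoints W (v.1.adicCompletion K))) =
            Literature.NumberTheory.EllipticCurves.resOfLe (localPoints W (v.1.adicCompletion K))
              (Subgroup.comap_mono le_top :
                localSubgroup (κ.layerSubgroup 0) (v.1.adicCompletion K) ≤
                  localSubgroup (⊤ : Subgroup (absoluteGaloisGroup K)) (v.1.adicCompletion K))
              (W.localResOver p ⊤ (v.1.adicCompletion K) Y))
    (Θ : AddSubgroup (W.subgroupH1 p (⊤ : Subgroup (absoluteGaloisGroup K))))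
    (hΘ : ∀ Y : W.subgroupH1 p (⊤ : Subgroup (absoluteGaloisGroup K)), Y ∈ Θ ↔
        Y ∈ unramifiedOutside (⊤ : Subgroup (absoluteGaloisGroup K)) (W.geomPrimaryTorsion p) p
            ((↑S : Set (HeightOneSpectrum (𝓞 K))) ∪ {v₀}) ∧
          (∀ v ∈ S, Literature.NumberTheory.EllipticCurves.resOfLe (localPoints W (v.adicCompletion K))
            (Subgroup.comap_mono le_top :
              localSubgroup κ.kerSubgroup (v.adicCompletion K) ≤
                localSubgroup (⊤ : Subgroup (absoluteGaloisGroup K)) (v.adicCompletion K))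
            (W.localResOver p ⊤ (v.adicCompletion K) Y) = 0) ∧
          ∀ w : InfinitePlace K, W.localResOver p ⊤ w.Completion Y = 0)
    (U : AddSubgroup (W.subgroupH1 p (⊤ : Subgroup (absoluteGaloisGroup K))))
    (hU : ∀ u : W.subgroupH1 p (⊤ : Subgroup (absoluteGaloisGroup K)), u ∈ U ↔
        u ∈ unramifiedOutside (⊤ : Subgroup (absoluteGaloisGroup K)) (W.geomPrimaryTorsion p) p
            ((↑S : Set (HeightOneSpectrum (𝓞 K))) ∪ {v₀}) ∧
          (∀ v ∈ S, W.localResOver p ⊤ (v.adicCompletion K) u = 0) ∧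
          ∀ w : InfinitePlace K, W.localResOver p ⊤ w.Completion u = 0)
    (P₀ : AddSubgroup (discreteH1 (localSubgroup (⊤ : Subgroup (absoluteGaloisGroup K)) (v₀.adicCompletion K))
      (localPoints W (v₀.adicCompletion K))))
    (lamP : Θ →+ P₀) (hlamP : ∀ Y : Θ, (lamP Y : discreteH1 (localSubgroup (⊤ : Subgroup (absoluteGaloisGroup K))
      (v₀.adicCompletion K)) (localPoints W (v₀.adicCompletion K))) = W.localResOver p ⊤ (v₀.adicCompletion K) Y)
    (δ : P₀ →+ C) (hδ : ∀ z : P₀, δ z = 0 ↔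
      (z : discreteH1 (localSubgroup (⊤ : Subgroup (absoluteGaloisGroup K)) (v₀.adicCompletion K))
        (localPoints W (v₀.adicCompletion K))) ∈ AddSubgroup.map (W.localResOver p ⊤ (v₀.adicCompletion K)) U)
    (hT : ∀ v ∈ S, Finite (W.localTowerKerPrimary κ (v.adicCompletion K) 0)) :
    Nat.card (∀ v : S, W.localTowerKerPrimary κ (v.1.adicCompletion K) 0) ≤
      Nat.card Ψ.range * Nat.card (δ.comp lamP).range := by
  classical
  haveI : ∀ v : S, Finite (W.localTowerKerPrimary κ (v.1.adicCompletion K) 0) := fun v ↦ hT v.1 v.2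
  have hle : ∀ (E : Type) [Field E] [Algebra K E],
      localSubgroup κ.kerSubgroup E ≤ localSubgroup (⊤ : Subgroup (absoluteGaloisGroup K)) E :=
    fun E _ _ ↦ Subgroup.comap_mono le_top
  have hleL : ∀ (E : Type) [Field E] [Algebra K E],
      localSubgroup (κ.layerSubgroup 0) E ≤ localSubgroup (⊤ : Subgroup (absoluteGaloisGroup K)) E :=
    fun E _ _ ↦ Subgroup.comap_mono le_top
  have hge : ∀ (E : Type) [Field E] [Algebra K E],
      localSubgroup (⊤ : Subgroup (absoluteGaloisGroup K)) E ≤ localSubgroup (κ.layerSubgroup 0) E :=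
    fun E _ _ ↦ Subgroup.comap_mono (ZpExtension.layerSubgroup_zero (κ := κ)).ge
  -- `ΦS : Θ → ∏ 𝒦` (sealed)
  have hmemT : ∀ Y : W.subgroupH1 p (⊤ : Subgroup (absoluteGaloisGroup K)), Y ∈ Θ → ∀ v ∈ S,
      Literature.NumberTheory.EllipticCurves.resOfLe (localPoints W (v.adicCompletion K)) (hleL (v.adicCompletion K))
        (W.localResOver p ⊤ (v.adicCompletion K) Y) ∈ W.localTowerKerPrimary κ (v.adicCompletion K) 0 := by
    intro Y hY v hv
    obtain ⟨-, hYS, -⟩ := (hΘ Y).mp hY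
    obtain ⟨k, hk⟩ := SignedEC.H1SigmaCorank.exists_pow_smul_eq_zero_subgroupH1_top W p Y
    refine (W.mem_localTowerKerPrimary_iff κ _ 0 _).mpr ⟨?_, k, ?_⟩
    · rw [W.mem_localTowerKer_iff κ]
      have e := congrArg (fun f ↦ f (W.localResOver p ⊤ (v.adicCompletion K) Y))
        (resOfLe_comp_holds (M := localPoints W (v.adicCompletion K))
          (WeierstrassCurve.localSubgroup_ker_le_layer κ (v.adicCompletion K) 0) (hleL (v.adicCompletion K)))
      simp only [AddMonoidHom.coe_comp, Function.comp_apply] at e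
      exact e.trans (hYS v hv)
    · have h : p ^ k • W.localResOver p ⊤ (v.adicCompletion K) Y = 0 := by rw [← map_nsmul, hk, map_zero]
      rw [← map_nsmul, h, map_zero]
  obtain ⟨ΦS, hΦS⟩ : ∃ ΦS : Θ →+ (∀ v : S, W.localTowerKerPrimary κ (v.1.adicCompletion K) 0),
      ∀ (Y : Θ) (v : S), ((ΦS Y v : W.localTowerKerPrimary κ (v.1.adicCompletion K) 0) :
          discreteH1 (localSubgroup (κ.layerSubgroup 0) (v.1.adicCompletion K)) (localPoints W (v.1.adicCompletion K))) =
        Literature.NumberTheory.EllipticCurves.resOfLe (localPoints W (v.1.adicCompletion K))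
          (hleL (v.1.adicCompletion K)) (W.localResOver p ⊤ (v.1.adicCompletion K) Y) :=
    ⟨{ toFun := fun Y v ↦ ⟨Literature.NumberTheory.EllipticCurves.resOfLe (localPoints W (v.1.adicCompletion K))
            (hleL (v.1.adicCompletion K)) (W.localResOver p ⊤ (v.1.adicCompletion K) Y), hmemT Y Y.2 v v.2⟩,
       map_zero' := funext fun v ↦ Subtype.ext (by
         change Literature.NumberTheory.EllipticCurves.resOfLe (localPoints W (v.1.adicCompletion K))
             (hleL (v.1.adicCompletion K)) (W.localResOver p ⊤ (v.1.adicCompletion K) ((0 : Θ) : W.subgroupH1 p ⊤)) = 0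
         rw [ZeroMemClass.coe_zero, map_zero, map_zero]),
       map_add' := fun Y Y' ↦ funext fun v ↦ Subtype.ext (by
         change Literature.NumberTheory.EllipticCurves.resOfLe (localPoints W (v.1.adicCompletion K))
             (hleL (v.1.adicCompletion K)) (W.localResOver p ⊤ (v.1.adicCompletion K) ((Y + Y' : Θ) : W.subgroupH1 p ⊤)) =
           Literature.NumberTheory.EllipticCurves.resOfLe (localPoints W (v.1.adicCompletion K))
             (hleL (v.1.adicCompletion K)) (W.localResOver p ⊤ (v.1.adicCompletion K) Y) +
           Literature.NumberTheory.EllipticCurves.resOfLe (localPoints W (v.1.adicCompletion K))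
             (hleL (v.1.adicCompletion K)) (W.localResOver p ⊤ (v.1.adicCompletion K) Y')
         rw [AddMemClass.coe_add, map_add, map_add]) }, fun _ _ ↦ rfl⟩
  -- `ΦS` is onto (erase-one at `v₀`)
  have hΦSsurj : Function.Surjective ΦS := by
    intro x
    obtain ⟨Y, hYH, hYS, hYinf⟩ := exists_lift_of_pi_localTowerKerPrimary W p κ hSel S hS v₀ hv₀ x
    have hYΘ : Y ∈ Θ := by
      refine (hΘ Y).mpr ⟨hYH, fun v hv ↦ ?_, hYinf⟩
      rw [hYS v hv]
      have e := congrArg (fun f ↦ f ((x ⟨v, hv⟩ : W.localTowerKerPrimary κ (v.adicCompletion K) 0) :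
          discreteH1 (localSubgroup (κ.layerSubgroup 0) (v.adicCompletion K)) (localPoints W (v.adicCompletion K))))
        (resOfLe_comp_holds (M := localPoints W (v.adicCompletion K)) (hle (v.adicCompletion K)) (hge (v.adicCompletion K)))
      simp only [AddMonoidHom.coe_comp, Function.comp_apply] at e
      exact e.trans ((W.mem_localTowerKerPrimary_iff κ _ 0 _).mp (x ⟨v, hv⟩).2).1
    refine ⟨⟨Y, hYΘ⟩, funext fun v ↦ Subtype.ext ?_⟩
    rw [hΦS]
    have e1 := congrArg (fun f ↦ f ((x v : W.localTowerKerPrimary κ (v.1.adicCompletion K) 0) :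
        discreteH1 (localSubgroup (κ.layerSubgroup 0) (v.1.adicCompletion K)) (localPoints W (v.1.adicCompletion K))))
      (resOfLe_comp_holds (M := localPoints W (v.1.adicCompletion K)) (hleL (v.1.adicCompletion K)) (hge (v.1.adicCompletion K)))
    have e2 := congrArg (fun f ↦ f ((x v : W.localTowerKerPrimary κ (v.1.adicCompletion K) 0) :
        discreteH1 (localSubgroup (κ.layerSubgroup 0) (v.1.adicCompletion K)) (localPoints W (v.1.adicCompletion K))))
      (resOfLe_refl_holds (M := localPoints W (v.1.adicCompletion K)) (localSubgroup (κ.layerSubgroup 0) (v.1.adicCompletion K)))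
    have h3 : W.localResOver p ⊤ (v.1.adicCompletion K) Y =
        Literature.NumberTheory.EllipticCurves.resOfLe (localPoints W (v.1.adicCompletion K))
          (hge (v.1.adicCompletion K)) ((x v : W.localTowerKerPrimary κ (v.1.adicCompletion K) 0) :
            discreteH1 (localSubgroup (κ.layerSubgroup 0) (v.1.adicCompletion K)) (localPoints W (v.1.adicCompletion K))) :=
      hYS v.1 v.2
    change Literature.NumberTheory.EllipticCurves.resOfLe (localPoints W (v.1.adicCompletion K))
        (hleL (v.1.adicCompletion K)) (W.localResOver p ⊤ (v.1.adicCompletion K) Y) = _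
    rw [h3]
    exact e1.trans e2
  -- the kernel `N` of `δ ∘ lamP` maps into `Ψ(A₀/Sel₀)`
  have hMle : ((δ.comp lamP).ker.map ΦS) ≤ Ψ.range := by
    rintro _ ⟨Y, hY, rfl⟩
    have hY' : (δ.comp lamP) Y = 0 := hY
    rw [AddMonoidHom.comp_apply, hδ, hlamP, AddSubgroup.mem_map] at hY'
    obtain ⟨u, huU, hu⟩ := hY'
    obtain ⟨huH, huS, huinf⟩ := (hU u).mp huU
    obtain ⟨hYH, hYS, hYinf⟩ := (hΘ Y).mp Y.2
    -- the criterion of part 1 applied to `Y − u`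
    obtain ⟨q, hq⟩ := hΨrange ((Y : W.subgroupH1 p (⊤ : Subgroup (absoluteGaloisGroup K))) - u)
      (AddSubgroup.sub_mem _ hYH huH)
      (fun v hv ↦ by rw [map_sub, huS v hv, sub_zero]; exact hYS v hv)
      (by rw [map_sub, hu]; exact sub_self _)
      (fun w ↦ by rw [map_sub, hYinf w, huinf w, sub_zero])
    refine ⟨q, funext fun v ↦ Subtype.ext ?_⟩
    rw [hq v, hΦS, map_sub, huS v.1 v.2, sub_zero]
    rfl
  -- count: `#∏𝒦 = #ΦS(N) · [∏𝒦 : ΦS(N)]`, `ΦS(N) ≤ Ψ(A₀/Sel₀)`, `[∏𝒦 : ΦS(N)] ∣ [Θ : N] = #(δ ∘ lamP)(Θ)`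
  haveI : Finite (δ.comp lamP).range := inferInstance
  have hd : Nat.card ((δ.comp lamP).ker.map ΦS) ≤ Nat.card Ψ.range :=
    Nat.card_le_card_of_injective _ (AddSubgroup.inclusion_injective hMle)
  have hidx : ((δ.comp lamP).ker.map ΦS).index ≤ Nat.card (δ.comp lamP).range := by
    have h := AddSubgroup.index_map_dvd (H := (δ.comp lamP).ker) hΦSsurj
    rw [AddSubgroup.index_ker] at h
    exact Nat.le_of_dvd Nat.card_pos h
  calc Nat.card (∀ v : S, W.localTowerKerPrimary κ (v.1.adicCompletion K) 0)
      = Nat.card ((δ.comp lamP).ker.map ΦS) * ((δ.comp lamP).ker.map ΦS).index :=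
        (AddSubgroup.card_mul_index _).symm
    _ ≤ Nat.card Ψ.range * Nat.card (δ.comp lamP).range := Nat.mul_le_mul hd hidx

end Summit.BirchSwinnertonDyer.BirchSwinnertonDyer.Theorems.TorsionEulerChar

end
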